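import Literature.IUT.HodgeArakelov.CohomologyLimitRestriction
import Literature.AnabelianGeometry.EtaleTheta.ContH1ResInjective

/-!
# Injectivity of the restriction of cohomology limits (Cor. 1.12 (c): the "natural inclusion")

Proof-only companion (abc-iut cell, D-0067 wave 4, seat abc-iut-w4-d041) of abc-iut-L6-t1's
`CohomologyLimitRestriction.lean` (`h1LimRestrict : h1Lim φ A H J →+ h1Lim φ A D J`, `D ≤ H`). No definitions.

S. Mochizuki, *Inter-universal Teichmüller theory II*, kurims manuscript (Dec. 2020), Cor. 1.12 (c), p. 56:
"one has a natural inclusion `M^×_TM(Π) ↪ lim_J H¹(J, (l·Δ_Θ)(Π))`, hence a natural inclusion of `M^×_TM(Π)`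
into the inductive limit of the first line [`lim_J H¹(Π_Ÿ(Π)|_J, (l·Δ_Θ)(Π))`]" — the map between the two
limits is `h1LimRestrict φ A ⊤ Π_Ÿ(Π) ⊥`, level-wise the restriction `H¹(J, ·) → H¹(Π_Ÿ(Π) ∩ J, ·)` to an open
normal subgroup of INFINITE index (Rmk. 1.4.1 (ii), p. 28: `Gal(Ÿ/X̲̲) ↠ l·ℤ`), so its injectivity — the field
`ThetaEvaluation.inclHd_injective` of `ConstantMultipleRigidity.lean` at the model — is not formal.

WHAT IS PROVED (abelian-group / cohomology plumbing, no statement of [IUTchII] or [EtTh] asserted):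
* `h1LimRestrict_injective`: a directed colimit of a level-wise injective morphism of directed systems is
  injective (via `AddCommGroup.DirectLimit.of.zero_exact` on the TARGET system and abc-iut-L6-t1's
  `gmodRestrict_fmod`), so `h1LimRestrict` is injective as soon as every level-wise restriction
  `H¹(H ⊓ K, A) → H¹(D ⊓ K, A)` is;
* `h1LimRestrict_injective_of_forall_fixed_eq_one`: … which holds (`ContH1.res_injective_of_forall_fixed_eq_one`,
  the `A^N = 1` case of inflation–restriction, [cite: NeukirchSchmidtWingberg2008, I §6]) whenever `D` is normal
  in `Π` and no element of `A` other than `1` is fixed by `D ∩ K` for `K` finite-index open — at the model: the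
  cyclotome `(l·Δ_Θ)(Π)` has no nontrivial invariants under an open subgroup of `Π_Ÿ(Π)` (finitely many roots
  of unity in finite extensions of `k`), an input to be supplied BY NAME by the instantiating seat.
Claim key of the interface `Mochizuki2012` (D-0012, disputed); typed ≠ any claim on [IUTchIII] Cor. 3.12.
-/

namespace Literature.IUT.HodgeArakelov

open Literature.AnabelianGeometry.EtaleTheta CohomologySystemOfContH1

universe u

noncomputable section

variable {P : TopGroup.{u}} {G' : Type u} [Group G'] [TopologicalSpace G'] [IsTopologicalGroup G']
  (φ : P →* G') (A : Subgroup G') [A.Normal] [IsMulCommutative A] {H D : Subgroup P} (hDH : D ≤ H)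

/-- A directed colimit of a LEVEL-WISE INJECTIVE morphism of directed systems is injective: if every
restriction `H¹(H ⊓ K, A) → H¹(D ⊓ K, A)` (`K ⊇ J` finite-index open) is injective, so is
`h1LimRestrict : h1Lim φ A H J →+ h1Lim φ A D J`. [cite: Mochizuki2012, Cor 1.12 p.56] -/
theorem h1LimRestrict_injective (J : Subgroup P)
    (hinj : ∀ i : Idx (P := P) J, Function.Injective (gmodRestrict φ A hDH J i)) :
    Function.Injective (h1LimRestrict φ A hDH J) := by
  haveI := Idx.isDirected (P := P) J
  haveI : Nonempty (Idx (P := P) J) := ⟨Idx.top J⟩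
  haveI : DirectedSystem (Gmod φ A D J) fun i j hij => fmod φ A D J i j hij := directedSystem φ A D J
  rw [injective_iff_map_eq_zero]
  intro x hx
  induction x using AddCommGroup.DirectLimit.induction_on with
  | ih i y =>
    change h1LimRestrict φ A hDH J (h1Of φ A H J i y) = 0 at hx
    rw [h1LimRestrict_of] at hx
    obtain ⟨j, hij, hj⟩ := AddCommGroup.DirectLimit.of.zero_exact (G := Gmod φ A D J)
      (f := fmod φ A D J) i (gmodRestrict φ A hDH J i y) hx
    rw [← gmodRestrict_fmod] at hj
    have hy : fmod φ A H J i j hij y = 0 := hinj j (by rw [hj, map_zero])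
    change h1Of φ A H J i y = 0
    rw [← h1Of_fmod φ A H J hij y, hy, map_zero]

/-- The level-wise restriction `H¹(H ⊓ K, A) → H¹(D ⊓ K, A)` is injective when `D ⊓ K` is normal in `H ⊓ K` and
`A` has no element `≠ 1` fixed by `D ⊓ K` (`ContH1.res_injective_of_forall_fixed_eq_one`).
[cite: NeukirchSchmidtWingberg2008, I §6] -/
theorem gmodRestrict_injective_of_forall_fixed_eq_one (J : Subgroup P) (i : Idx (P := P) J)
    (hnorm : ((D ⊓ i.K).subgroupOf (H ⊓ i.K)).Normal)
    (hfix : ∀ a : A, (∀ n : P, n ∈ D ⊓ i.K → MulAut.conjNormal (φ n) a = a) → a = 1) :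
    Function.Injective (gmodRestrict φ A hDH J i) := fun _ _ hxy =>
  Additive.toMul.injective
    (ContH1.res_injective_of_forall_fixed_eq_one (inf_le_inf_right i.K hDH) hnorm hfix
      (congrArg Additive.toMul hxy))

/-- If `D` is normal in `Π`, then `D ⊓ K` is normal in `H ⊓ K` for every `K` (used with `K` finite-index
open). [cite: Mochizuki2012, Cor 1.12 p.56] -/
theorem inf_subgroupOf_inf_normal [hD : D.Normal] (K : Subgroup P) : ((D ⊓ K).subgroupOf (H ⊓ K)).Normal := by
  refine ⟨fun n hn g => ?_⟩
  rw [Subgroup.mem_subgroupOf] at hn ⊢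
  refine ⟨hD.conj_mem _ hn.1 _, ?_⟩
  exact K.mul_mem (K.mul_mem g.2.2 hn.2) (K.inv_mem g.2.2)

/-- **Injectivity of the restriction of the limits** (the "natural inclusion" of Cor. 1.12 (c), kurims
p. 56, in the instantiated cohomology systems): for `D ⊴ Π` normal with `D ≤ H`, if no element of `A` other
than `1` is fixed by `D ∩ K` for any finite-index open `K ⊇ J`, then
`h1LimRestrict : lim_K H¹(H|_K, A) → lim_K H¹(D|_K, A)` is injective. [cite: Mochizuki2012, Cor 1.12 p.56] -/
theorem h1LimRestrict_injective_of_forall_fixed_eq_one [D.Normal] (J : Subgroup P)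
    (hfix : ∀ K : Subgroup P, K.FiniteIndex → IsOpen (K : Set P) → J ≤ K →
      ∀ a : A, (∀ n : P, n ∈ D ⊓ K → MulAut.conjNormal (φ n) a = a) → a = 1) :
    Function.Injective (h1LimRestrict φ A hDH J) :=
  h1LimRestrict_injective φ A hDH J fun i =>
    gmodRestrict_injective_of_forall_fixed_eq_one φ A hDH J i (inf_subgroupOf_inf_normal (K := i.K))
      (hfix i.K (OrderDual.ofDual i).2.1 (OrderDual.ofDual i).2.2.1 (OrderDual.ofDual i).2.2.2)

end

end Literature.IUT.HodgeArakelov
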